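import Summits.QuantumFields.BalabanUV.T4Continuum.Support.NE7LawLevelOldLayers

/-!
# NE7, ROAD P4 (law-level): NODE Q.old, item (k8) — ONE BACKWARD STEP'S LAYER BUDGET FROM A ONE-STEP POINCARÉ PROFILE
# (the open input (QV) isolated as a bare inequality, (QL) as the local Lipschitz numbers, locality as supports)

(Cell `pub-balaban`, sub-cell `t4`, binder row NE7 = node U5, co-owner #4 `b2b-balaban-t4-ne7-p4`, gen 2; skeleton
`HOME/t4/skeletons/NE7-t4-ne7-p4.md` v1.7 §2 NODE Q.old, leaves (QV_j)∕(QL_j); GAPS G-ne7p4-3 ∕ G-ne7p4-4.  Imports the road's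
`NE7LawLevelOldLayers` (p209362) and through it row NE1′'s [folklore] `T4MeanChannel` (`incr`, tower, mean channel).)

HONEST FRAMING (T4-DAG PAGE 1).  Rung (B)+1 on ONE FIXED finite four-torus, CONDITIONAL on `BetaPertH` and the nine
spine estimates (0/9 proved); NOT infinite volume, NOT a mass gap, NOT the Clay problem.  NE7 is NOT PRINTED and NOT
proved here; the `def … : Prop` below is a HYPOTHESIS SHAPE over plain data, every theorem is [folklore] measure theory ∕
finite-sum bookkeeping, sorry-free; no statement of the audited series is asserted or used; NOT summit progress.

WHAT THIS FILE DOES.  The field `layer n j` of `OldLayerDatum(L1)` asks for a number `vLayer n j` with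
`∫ (incr P (𝓕 n) (S n) j)² ≤ vLayer n j` — ONE backward RG step's conditional variance of the conditional mean
`P[S n | 𝓕 n j]`.  The skeleton (v1.7) says this number is (QV) × (QL)² × counts: a ONE-STEP Poincaré ∕ Brascamp–Lieb
constant for the step's fibre law, times the squared local Lipschitz constants of the components' conditional functionals,
summed with locality.  This file types exactly that factorisation:
* §1 `PoincareProfile μ m₁ m₂ C sites D` — (QV) AS A BARE SHAPE: for every `m₁`-measurable bounded `g`,
  `∫ (g − μ[g|m₂])² ≤ C · Σ_{b∈sites} (D b g)²`, where `D b` is a subadditive, non-negative «oscillation in the coordinate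
  `b`» functional vanishing on `0` (DICTIONARY: `m₁ ⊇ m₂` two consecutive members of the reverse filtration; `sites` the
  fluctuation variables of ONE T-step (+ the level's resampling noise); `D b g` the Lipschitz constant of `g` in the
  variable `b`; `C` the Brascamp–Lieb ∕ Poincaré constant of the gauge-fixed fibre law on its convex small-field domain,
  large-field events of the step booked inside `C`∕`D` through their probabilities — NOT PRINTED, NOT proved);
* §2 LOCALITY BOOKKEEPING `D_sum_le_of_supports`: for a finite family `φ i` with supports `supp i ⊆ sites` and (QL) numbers
  `ℓ i` (`D b (φ i) ≤ ℓ i`, and `D b (φ i) = 0` off `supp i`), `D b (Σ_i φ i) ≤ Σ_{i : b ∈ supp i} ℓ i` (pure algebra);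
* §3 `integral_incr_sq_le_of_poincareProfile`: if `Φ = Σ_i φ i` is an `F j`-measurable bounded VERSION of `μ[S|F j]`
  (DICTIONARY: the conditional mean of the age-`n` summand given the level-`(k+j)` state, decomposed over the candidate
  components — [dict]), then `∫ (incr μ F S j)² = ∫ (Φ − μ[Φ|F (j+1)])² ≤ C · Σ_b (Σ_{i : b ∈ supp i} ℓ i)²`; and the
  COUNTING FORM `…_count`: if every site meets at most `M` supports and `ℓ i ≤ ℓ₀`, the bound is `C · #sites · (M·ℓ₀)²`
  (the skeleton's `vLayer n j ≍ C_P · L^{4(n−j−1)} · (L^{4(j+1)} e^{−p₀} δ R² g L^{−2j})²`, up to the dilution `L^{−6n}`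
  carried inside `ℓ`).
Nothing here is an estimate for Bałaban's fibre laws: (QV) is the hypothesis `PoincareProfile`, (QL) the numbers `ℓ i`,
locality the sets `supp i`; the file only certifies that these three data produce the `layer` field.
-/

noncomputable section

open MeasureTheory Finset
open scoped BigOperators

namespace Summit.QuantumFields.BalabanUV.T4Continuum.NE7LawLevel

open Literature.MathematicalPhysics.QuantumFieldTheory.Balaban1983to89
open Literature.MathematicalPhysics.QuantumFieldTheory.Balaban1983to89.T4MeanChannel

/-! ## §1 (QV) as a bare shape: the one-step Poincaré profile -/

section Profile

variable {Ω : Type*} {mΩ : MeasurableSpace Ω} {β : Type*}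

/-- **(QV) AS A HYPOTHESIS SHAPE — ONE-STEP POINCARÉ PROFILE (NOT PRINTED, NOT proved for Bałaban's fibre laws).**
`D b g ≥ 0` is a subadditive «oscillation of `g` in the coordinate `b`» vanishing on the zero function, `0 ≤ C`, and for
every `m₁`-strongly-measurable bounded `g`: `∫ (g − μ[g|m₂])² dμ ≤ C · Σ_{b∈sites} (D b g)²`.  (For a product ∕ log-concave
fibre law this is Efron–Stein ∕ Brascamp–Lieb with `D b` the Lipschitz constant in the variable `b`.) [folklore] -/
def PoincareProfile (μ : Measure Ω) (m₁ m₂ : MeasurableSpace Ω) (C : ℝ) (sites : Finset β)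
    (D : β → (Ω → ℝ) → ℝ) : Prop :=
  0 ≤ C ∧ (∀ b, D b (fun _ => 0) = 0) ∧ (∀ b g, 0 ≤ D b g) ∧
    (∀ b (g h : Ω → ℝ), D b (fun ω => g ω + h ω) ≤ D b g + D b h) ∧
    ∀ g : Ω → ℝ, StronglyMeasurable[m₁] g → (∃ B : ℝ, ∀ ω, |g ω| ≤ B) →
      ∫ ω, (g ω - μ[g|m₂] ω) ^ 2 ∂μ ≤ C * ∑ b ∈ sites, D b g ^ 2

end Profile

/-! ## §2 Locality bookkeeping: the oscillation of a sum of local pieces -/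

section Locality

variable {Ω : Type*} {β ι : Type*} {D : β → (Ω → ℝ) → ℝ}

/-- Subadditivity over a finite sum: `D b (Σ_{i∈s} φ i) ≤ Σ_{i∈s} D b (φ i)`. [folklore] -/
theorem D_finset_sum_le (hD0 : ∀ b, D b (fun _ => 0) = 0)
    (hDadd : ∀ b (g h : Ω → ℝ), D b (fun ω => g ω + h ω) ≤ D b g + D b h) (b : β) (s : Finset ι)
    (φ : ι → Ω → ℝ) : D b (fun ω => ∑ i ∈ s, φ i ω) ≤ ∑ i ∈ s, D b (φ i) := by
  classical
  induction s using Finset.induction_on with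
  | empty => simp [hD0 b]
  | insert a s ha ih =>
    have heq : (fun ω => ∑ i ∈ insert a s, φ i ω) = fun ω => φ a ω + ∑ i ∈ s, φ i ω := by
      funext ω; rw [sum_insert ha]
    rw [heq, sum_insert ha]
    exact (hDadd b (φ a) fun ω => ∑ i ∈ s, φ i ω).trans (add_le_add le_rfl ih)

/-- **LOCALITY BOOKKEEPING.**  If each piece `φ i` has oscillation `≤ ℓ i` in every coordinate and ZERO oscillation off its
support `supp i`, then `D b (Σ_i φ i) ≤ Σ_{i∈comps, b∈supp i} ℓ i`. [folklore] -/
theorem D_sum_le_of_supports [DecidableEq β] (hD0 : ∀ b, D b (fun _ => 0) = 0)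
    (hDadd : ∀ b (g h : Ω → ℝ), D b (fun ω => g ω + h ω) ≤ D b g + D b h) (comps : Finset ι) (φ : ι → Ω → ℝ)
    (supp : ι → Finset β) (ℓ : ι → ℝ) (hℓ : ∀ i ∈ comps, ∀ b, D b (φ i) ≤ ℓ i)
    (hoff : ∀ i ∈ comps, ∀ b, b ∉ supp i → D b (φ i) = 0) (b : β) :
    D b (fun ω => ∑ i ∈ comps, φ i ω) ≤ ∑ i ∈ comps.filter (fun i => b ∈ supp i), ℓ i := by
  refine (D_finset_sum_le hD0 hDadd b comps φ).trans ?_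
  rw [sum_filter]
  refine sum_le_sum fun i hi => ?_
  by_cases hb : b ∈ supp i
  · rw [if_pos hb]; exact hℓ i hi b
  · rw [if_neg hb, hoff i hi b hb]

/-- The locality sum is non-negative when the `ℓ i` are. [folklore] -/
theorem sum_filter_nonneg [DecidableEq β] (comps : Finset ι) (supp : ι → Finset β) {ℓ : ι → ℝ}
    (hℓ0 : ∀ i ∈ comps, 0 ≤ ℓ i) (b : β) : 0 ≤ ∑ i ∈ comps.filter (fun i => b ∈ supp i), ℓ i :=
  sum_nonneg fun i hi => hℓ0 i (mem_filter.mp hi).1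

/-- COUNTING FORM of the locality sum: if at most `M` supports meet `b` and `ℓ i ≤ ℓ₀` (with `0 ≤ ℓ₀`), then
`Σ_{i : b∈supp i} ℓ i ≤ M·ℓ₀`. [folklore] -/
theorem sum_filter_le_count_mul [DecidableEq β] (comps : Finset ι) (supp : ι → Finset β) {ℓ : ι → ℝ} {ℓ₀ : ℝ}
    (hℓ : ∀ i ∈ comps, ℓ i ≤ ℓ₀) {M : ℕ} (b : β) (hM : (comps.filter (fun i => b ∈ supp i)).card ≤ M)
    (hℓ₀ : 0 ≤ ℓ₀) : ∑ i ∈ comps.filter (fun i => b ∈ supp i), ℓ i ≤ M * ℓ₀ := by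
  calc ∑ i ∈ comps.filter (fun i => b ∈ supp i), ℓ i ≤ ∑ _i ∈ comps.filter (fun i => b ∈ supp i), ℓ₀ :=
        sum_le_sum fun i hi => hℓ i (mem_filter.mp hi).1
    _ = (comps.filter (fun i => b ∈ supp i)).card * ℓ₀ := by rw [sum_const, nsmul_eq_mul]
    _ ≤ M * ℓ₀ := mul_le_mul_of_nonneg_right (Nat.cast_le.mpr hM) hℓ₀

end Locality

/-! ## §3 The `layer` field from the profile, the pieces and their supports -/

section Layer

variable {Ω : Type*} {mΩ : MeasurableSpace Ω} {μ : Measure Ω} {F : ℕ → MeasurableSpace Ω} {β ι : Type*}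

/-- The increment is a.e. the Poincaré deviation of any `F j`-measurable VERSION `Φ` of `μ[S|F j]`:
`incr μ F S j =ᵐ Φ − μ[Φ|F (j+1)]` (tower property + `condExp_congr_ae`). [folklore] -/
theorem incr_ae_eq_sub_condExp [IsFiniteMeasure μ] (hF : Antitone F) (hFle : ∀ j, F j ≤ mΩ) (S : Ω → ℝ) (j : ℕ)
    {Φ : Ω → ℝ} (hΦ : Φ =ᵐ[μ] μ[S|F j]) :
    incr μ F S j =ᵐ[μ] fun ω => Φ ω - μ[Φ|F (j + 1)] ω := by
  haveI : SigmaFinite (μ.trim (hFle j)) := inferInstance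
  have h1 : μ[μ[S|F j] | F (j + 1)] =ᵐ[μ] μ[S|F (j + 1)] := condExp_condExp_of_le (hF (Nat.le_succ j)) (hFle j)
  have h2 : μ[Φ | F (j + 1)] =ᵐ[μ] μ[μ[S|F j] | F (j + 1)] := condExp_congr_ae hΦ
  filter_upwards [hΦ, h1, h2] with ω hω h1ω h2ω
  rw [incr_apply, h2ω, h1ω, hω]

/-- **THE `layer` FIELD FROM (QV) × (QL) × LOCALITY.**  Let `PoincareProfile μ (F j) (F (j+1)) C sites D` hold, and let
`Φ = Σ_{i∈comps} φ i` be an `F j`-strongly-measurable bounded version of `μ[S|F j]` whose pieces have oscillations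
`D b (φ i) ≤ ℓ i`, vanishing off `supp i`.  Then
`∫ (incr μ F S j)² ≤ C · Σ_{b∈sites} (Σ_{i∈comps, b∈supp i} ℓ i)²`. [folklore] -/
theorem integral_incr_sq_le_of_poincareProfile [IsFiniteMeasure μ] [DecidableEq β] (hF : Antitone F)
    (hFle : ∀ j, F j ≤ mΩ) {S : Ω → ℝ} {j : ℕ} {C : ℝ} {sites : Finset β} {D : β → (Ω → ℝ) → ℝ}
    (hP : PoincareProfile μ (F j) (F (j + 1)) C sites D) (comps : Finset ι) (φ : ι → Ω → ℝ) (supp : ι → Finset β)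
    (ℓ : ι → ℝ) {Φ : Ω → ℝ} (hΦsum : ∀ ω, Φ ω = ∑ i ∈ comps, φ i ω) (hΦ : Φ =ᵐ[μ] μ[S|F j])
    (hΦm : StronglyMeasurable[F j] Φ) {B : ℝ} (hΦb : ∀ ω, |Φ ω| ≤ B) (hℓ : ∀ i ∈ comps, ∀ b, D b (φ i) ≤ ℓ i)
    (hoff : ∀ i ∈ comps, ∀ b, b ∉ supp i → D b (φ i) = 0) :
    ∫ ω, incr μ F S j ω ^ 2 ∂μ ≤ C * ∑ b ∈ sites, (∑ i ∈ comps.filter (fun i => b ∈ supp i), ℓ i) ^ 2 := by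
  obtain ⟨hC0, hD0, hDnn, hDadd, hPI⟩ := hP
  -- the increment's second moment is Φ's Poincaré deviation
  have hae := incr_ae_eq_sub_condExp hF hFle S j hΦ
  have heq : ∫ ω, incr μ F S j ω ^ 2 ∂μ = ∫ ω, (Φ ω - μ[Φ|F (j + 1)] ω) ^ 2 ∂μ :=
    integral_congr_ae (hae.mono fun ω hω => by
      show incr μ F S j ω ^ 2 = (Φ ω - μ[Φ|F (j + 1)] ω) ^ 2
      rw [hω])
  rw [heq]
  refine (hPI Φ hΦm ⟨B, hΦb⟩).trans (mul_le_mul_of_nonneg_left (sum_le_sum fun b _ => ?_) hC0)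
  -- per site: D b Φ ≤ Σ_{i : b ∈ supp i} ℓ i, both non-negative
  have hΦfun : Φ = fun ω => ∑ i ∈ comps, φ i ω := funext hΦsum
  have hle : D b Φ ≤ ∑ i ∈ comps.filter (fun i => b ∈ supp i), ℓ i := by
    rw [hΦfun]; exact D_sum_le_of_supports hD0 hDadd comps φ supp ℓ hℓ hoff b
  exact pow_le_pow_left₀ (hDnn b Φ) hle 2

/-- **COUNTING FORM** (the skeleton's engineering size): if moreover at most `M` supports meet each site and `ℓ i ≤ ℓ₀`
(`0 ≤ ℓ₀`), then `∫ (incr μ F S j)² ≤ C · #sites · (M·ℓ₀)²`. [folklore] -/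
theorem integral_incr_sq_le_of_poincareProfile_count [IsFiniteMeasure μ] [DecidableEq β] (hF : Antitone F)
    (hFle : ∀ j, F j ≤ mΩ) {S : Ω → ℝ} {j : ℕ} {C : ℝ} {sites : Finset β} {D : β → (Ω → ℝ) → ℝ}
    (hP : PoincareProfile μ (F j) (F (j + 1)) C sites D) (comps : Finset ι) (φ : ι → Ω → ℝ) (supp : ι → Finset β)
    (ℓ : ι → ℝ) {Φ : Ω → ℝ} (hΦsum : ∀ ω, Φ ω = ∑ i ∈ comps, φ i ω) (hΦ : Φ =ᵐ[μ] μ[S|F j])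
    (hΦm : StronglyMeasurable[F j] Φ) {B : ℝ} (hΦb : ∀ ω, |Φ ω| ≤ B) (hℓ : ∀ i ∈ comps, ∀ b, D b (φ i) ≤ ℓ i)
    (hℓ0 : ∀ i ∈ comps, 0 ≤ ℓ i) (hoff : ∀ i ∈ comps, ∀ b, b ∉ supp i → D b (φ i) = 0) {M : ℕ} {ℓ₀ : ℝ}
    (hM : ∀ b ∈ sites, (comps.filter (fun i => b ∈ supp i)).card ≤ M) (hℓle : ∀ i ∈ comps, ℓ i ≤ ℓ₀)
    (hℓ₀ : 0 ≤ ℓ₀) : ∫ ω, incr μ F S j ω ^ 2 ∂μ ≤ C * (sites.card * (M * ℓ₀) ^ 2) := by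
  refine (integral_incr_sq_le_of_poincareProfile hF hFle hP comps φ supp ℓ hΦsum hΦ hΦm hΦb hℓ hoff).trans
    (mul_le_mul_of_nonneg_left ?_ hP.1)
  calc ∑ b ∈ sites, (∑ i ∈ comps.filter (fun i => b ∈ supp i), ℓ i) ^ 2 ≤ ∑ _b ∈ sites, (M * ℓ₀) ^ 2 :=
        sum_le_sum fun b hb => pow_le_pow_left₀ (sum_filter_nonneg comps supp hℓ0 b)
          (sum_filter_le_count_mul comps supp hℓle b (hM b hb) hℓ₀) 2
    _ = sites.card * (M * ℓ₀) ^ 2 := by rw [sum_const, nsmul_eq_mul]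

end Layer

end Summit.QuantumFields.BalabanUV.T4Continuum.NE7LawLevel

end
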